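import Summits.ABC.IUTFork.DAGL6p
import Summits.ABC.IUTFork.DAGL6q
import Summits.ABC.IUTFork.DAGL6u

/-!
# Kernel DAG index — witness UPGRADE part e (GENERATED by abc-iut-c312-2 gen 4 `work/gen_index.py upgrade` @2026-08-26T08:03Z from HOME/plan/DAG.tsv
(regenerated 2026-08-26T08:01:08Z); spec v1.3 §2(c) "`_holds` iff the DAG row is discharged", §5 "re-file when nodes change status")

THIS FILE PROVES NOTHING NEW AND ASSERTS NOTHING. For 6 nodes ALREADY INDEXED with a partial witness `N_<id>_part` (their DAG row was
`landed(p…)` when indexed) whose row is NOW `discharged(p…)`, it adds the discharge witness `N_<id>_holds : N_<id> := N_<id>_part` BY NAME —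
the node statement `N_<id>` is untouched (append-only across files: nothing landed is redefined). Nothing here says abc is proved or refuted
or takes a side on [IUTchIII] Cor 3.12. typed ≠ discharged; indexed ≠ endorsed.
-/

namespace Summit.ABC.IUTFork.DAG

/-- [node IUTchII:Prop1.2(ii) · L6/D2 · DAG status discharged(p406189)] discharge witness of `N_IUTchII_Prop1_2_ii` (indexed in `DAGL6p` with `_part` while the row was landed; now discharged, p406189): BY NAME; proves nothing new. -/
theorem N_IUTchII_Prop1_2_ii_holds : N_IUTchII_Prop1_2_ii := N_IUTchII_Prop1_2_ii_part

/-- [node IUTchII:Prop1.4 · L6/D2 · DAG status discharged(p406189)] discharge witness of `N_IUTchII_Prop1_4` (indexed in `DAGL6p` with `_part` while the row was landed; now discharged, p406189): BY NAME; proves nothing new. -/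
theorem N_IUTchII_Prop1_4_holds : N_IUTchII_Prop1_4 := N_IUTchII_Prop1_4_part

/-- [node IUTchII:Cor1.12(i) · L6/D2 · DAG status discharged(p410537)] discharge witness of `N_IUTchII_Cor1_12_i` (indexed in `DAGL6q` with `_part` while the row was landed; now discharged, p410537): BY NAME; proves nothing new. -/
theorem N_IUTchII_Cor1_12_i_holds : N_IUTchII_Cor1_12_i := N_IUTchII_Cor1_12_i_part

/-- [node IUTchIII:Prop2.1(iv) · L6/D3 · DAG status discharged(p422834)] discharge witness of `N_IUTchIII_Prop2_1_iv` (indexed in `DAGL6u` with `_part` while the row was landed; now discharged, p422834): BY NAME; proves nothing new. -/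
theorem N_IUTchIII_Prop2_1_iv_holds : N_IUTchIII_Prop2_1_iv := N_IUTchIII_Prop2_1_iv_part

/-- [node IUTchIII:Prop2.1(v) · L6/D3 · DAG status discharged(p422834)] discharge witness of `N_IUTchIII_Prop2_1_v` (indexed in `DAGL6u` with `_part` while the row was landed; now discharged, p422834): BY NAME; proves nothing new. -/
theorem N_IUTchIII_Prop2_1_v_holds : N_IUTchIII_Prop2_1_v := N_IUTchIII_Prop2_1_v_part

/-- [node IUTchIII:Prop3.7(ii) · L6/D3 · DAG status discharged(p412491)] discharge witness of `N_IUTchIII_Prop3_7_ii` (indexed in `DAGL6u` with `_part` while the row was landed; now discharged, p412491): BY NAME; proves nothing new. -/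
theorem N_IUTchIII_Prop3_7_ii_holds : N_IUTchIII_Prop3_7_ii := N_IUTchIII_Prop3_7_ii_part

end Summit.ABC.IUTFork.DAG
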